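/-
Copyright (c) 2026. All rights reserved.
Released under Apache 2.0 license as described in the file LICENSE.
Authors: abc-iut cell, prover seat abc-iut-w5-d144 (gen 6; row «COR510iv-SB′», brick E input «D1b»), over abc-iut-L4-t3's
`IotaOver` / `LamOverLink` add-ons, abc-iut-f-101's `logObsFamily` and this seat's `DiagramChainFamiliesOver.lean`.
-/
import Literature.AnabelianGeometry.AbsoluteAnabelian.DiagramChainFamiliesOver
import Literature.AnabelianGeometry.AbsoluteAnabelian.DiagramOverTransport
import Literature.AnabelianGeometry.AbsoluteAnabelian.LogFrobeniusLamOverLink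
import Literature.AnabelianGeometry.AbsoluteAnabelian.LogFrobeniusObservablesOfIotaSquare
import HarnessLib

/-!
# [AbsTopIII] Cor 5.5 (iii) / Def 5.4 (iv)(vii): the homotopies of the observable `S_log⊞_v` lie over `Th•[Z]`

S. Mochizuki, *Topics in absolute anabelian geometry III: global reconstruction algorithms*,
J. Math. Sci. Univ. Tokyo 22 (2015) 939–1156 [MochizukiAbsTopIII2015]; manuscript `paper:url-5493eb38cbb7`: Def 5.4 (iv)
p. 127 ("`λ⊞_{v,ν}` … lie over `Th•[Z]`"), (vii) p. 128 (the `ι⊞_{v,ε}`), (ii) p. 125 ("`log•_{T,T}` lies over `Th•`"), Cor 5.5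
p. 130 (the diagram `D•`, proviso on the space-link / post-log vertices), (iii) p. 131 (the observable `S_log⊞_v`), Rmk
3.5.1 p. 78 (structure functors: «a 'constant portion' … 'under the entire diagram'»).

WHAT.  The observable's diagram `D•_{≤2} ∪ {𝒩⊞_v}` (`logDiagramPlus v`) LIES OVER `Th•[Z] = ℰ•` through the structure
functors `𝒳_⋎, □ ↦ proj`, `𝒩⊞_v ↦ (𝒩⊞_v → 𝒩_v → Th•[Z])`, the arrows lying over by the interface's own isomorphisms
`logOver` (`log`), the unitor (`id_⋎`), `lamOver v ν` (`λ⊞_{v,ν}`): `logPlusOverE v` (abc-iut-L4-t12's `OverData`).  With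
respect to it:

* `isOver_logGenHom` — GIVEN abc-iut-L4-t3's add-ons `IotaOver` (the `ι⊞` lie over `Th•[Z]`) and `LamOverLink` (one
  over-structure at the identified space-link / post-log vertices), BOTH printed kinds of generator pairs of `S_log⊞_v`
  (abc-iut-f-101's `LogGen.pre` / `LogGen.post`, homotopy `logGenHom` = `ι⊞_{v,ε}` re-typed) carry OVER-homotopies
  (abc-iut-f-101's `OverData.IsOver`): the component computation of abc-iut-f-102's THEOREM B (`hpre` / `hpost`), here
  against the observable's own small over-datum (abc-iut-L4-t3's `IotaOver.toE_map_iota_heq_of_preLog` / `_spaceLink`);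
* `isOver_logObsFamily_η` — ★ hence EVERY homotopy of the constructed observable `logObsFamily v hsq` lies over `Th•[Z]`
  (this seat's `isOver_chainFamily_η`): the hypothesis «hover⊞» of the Cor 5.10 (iv)(b) compatibility closer (row
  «COR510iv-SB′», abc-iut-f-101's brick D2) in over-datum form, for every setting satisfying the two add-ons;
* `isOver_logObsFamily_η_map` — the same over any category under `Th•[Z]` (abc-iut-f-101's `IsOver.map`,
  `DiagramOverTransport.lean`; e.g. along `ℰ• → ℰ⊢ ⥲ An⊢[𝒩⊢⊞]` of Cor 5.10 (iv)).

Interface-level (hypotheses `IotaOver`, `LamOverLink`, `IotaSquaresCommute`; no carrier); nothing here bears on [IUTchIII]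
Cor. 3.12; no side taken; typed ≠ proved.
-/

universe u

open CategoryTheory Quiver

namespace Literature.AnabelianGeometry.AbsoluteAnabelian

namespace LogFrobeniusSetting

variable {Vmod : Type u} {isArc : Vmod → Bool} (L : LogFrobeniusSetting Vmod isArc) (v : Vmod)

/-! ## The observable's diagram over `Th•[Z]` -/

/-- Structure functor of a vertex of `D•_{≤2}` towards `Th•[Z] = ℰ•`: `𝒳_⋎ ↦ proj`, `□ ↦ proj` (the other vertices of `D•⊢`
do not occur in `D•_{≤2}`). [cite: MochizukiAbsTopIII2015, Remark 3.5.1 p.78] -/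
def plusN : (x : DVertex Vmod isArc) → x.InFirstRows 2 → (x.category L ⥤ L.E)
  | .row1 _, _ => L.proj
  | .core, _ => L.proj
  | .nplus _, h => absurd h.2 (by change ¬ (3 ≤ 2); decide)
  | .nv _, h => absurd h.2 (by change ¬ (4 ≤ 2); decide)
  | .e5, h => absurd h.2 (by change ¬ (5 ≤ 2); decide)
  | .an, h => absurd h.2 (by change ¬ (6 ≤ 2); decide)
  | .e7, h => absurd h.2 (by change ¬ (7 ≤ 2); decide)
  | .nmonoPlus _, h => h.1.elim
  | .nmono _, h => h.1.elim
  | .emono5, h => h.1.elim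
  | .anMono, h => h.1.elim
  | .emono7, h => h.1.elim

/-- The arrows of `D•_{≤2}` lie over `Th•[Z]`: `log` by `logOver` (Def 5.4 (ii)), `id_⋎` by the unitor.
[cite: MochizukiAbsTopIII2015, Def 5.4 (ii) p. 125] -/
def plusμ : ∀ {x y : DVertex Vmod isArc} (e : DEdge isArc x y) (hx : x.InFirstRows 2) (hy : y.InFirstRows 2),
    DEdge.functor L e ⋙ L.plusN y hy ≅ L.plusN x hx
  | _, _, .log _, _, _ => L.logOver
  | _, _, .toCore _, _, _ => L.proj.leftUnitor
  | _, _, .lam _ _ _, _, hy => absurd hy.2 (by change ¬ (3 ≤ 2); decide)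
  | _, _, .forget _, hx, _ => absurd hx.2 (by change ¬ (3 ≤ 2); decide)
  | _, _, .toE _, hx, _ => absurd hx.2 (by change ¬ (4 ≤ 2); decide)
  | _, _, .κAn, hx, _ => absurd hx.2 (by change ¬ (5 ≤ 2); decide)
  | _, _, .anToE, hx, _ => absurd hx.2 (by change ¬ (6 ≤ 2); decide)
  | _, _, .monoNplus _, hx, _ => absurd hx.2 (by change ¬ (3 ≤ 2); decide)
  | _, _, .monoN _, hx, _ => absurd hx.2 (by change ¬ (4 ≤ 2); decide)
  | _, _, .monoE5, hx, _ => absurd hx.2 (by change ¬ (5 ≤ 2); decide)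
  | _, _, .monoAn, hx, _ => absurd hx.2 (by change ¬ (6 ≤ 2); decide)
  | _, _, .monoE7, hx, _ => absurd hx.2 (by change ¬ (7 ≤ 2); decide)
  | _, _, .forgetMono _, hx, _ => hx.1.elim
  | _, _, .toEmono _, hx, _ => hx.1.elim
  | _, _, .κAnMono, hx, _ => hx.1.elim
  | _, _, .anMonoToE, hx, _ => hx.1.elim

/-- The observation arrows `λ⊞_{v,ν} : □ → 𝒩⊞_v` lie over `Th•[Z]` by `lamOver v ν` (Def 5.4 (iv)).
[cite: MochizukiAbsTopIII2015, Def 5.4 (iv) p. 127] -/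
def plusμObs : ∀ {x : DVertex Vmod isArc} (i : DEdge isArc x (.nplus v)) (hx : x.InFirstRows 2),
    DEdge.functor L i ⋙ (L.forget v ⋙ L.toE v) ≅ L.plusN x hx
  | _, .lam _ ν _, _ => L.lamOver v ν

/-- **The observable's diagram `D•_{≤2} ∪ {𝒩⊞_v}` over `Th•[Z]`** (abc-iut-L4-t12's `OverData`): structure functors
`proj` on `D•_{≤2}` and `𝒩⊞_v → 𝒩_v → Th•[Z]` at the observation vertex; over-isomorphisms `logOver`, unitor, `lamOver`.
[cite: MochizukiAbsTopIII2015, Remark 3.5.1 p.78] -/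
def logPlusOverE : (L.logDiagramPlus v).OverData L.E where
  N a := match a with
    | ExtVertex.base a => L.plusN a.1 a.2
    | ExtVertex.obs => L.forget v ⋙ L.toE v
  μ {a b} e := match a, b, e with
    | ExtVertex.base a, ExtVertex.base b, e => L.plusμ e a.2 b.2
    | ExtVertex.base a, ExtVertex.obs, i => L.plusμObs v i a.2
    | ExtVertex.obs, ExtVertex.base _, j => PEmpty.elim j
    | ExtVertex.obs, ExtVertex.obs, e => PEmpty.elim e

/-- The structure functor at the observation vertex is `𝒩⊞_v → 𝒩_v → Th•[Z]`. [cite: MochizukiAbsTopIII2015, Remark 3.5.1 p.78] -/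
@[simp] theorem logPlusOverE_N_obs : (L.logPlusOverE v).N (logShapePlus (isArc := isArc) v).obs = (L.forget v ⋙ L.toE v) := rfl

/-- The structure functor at `□` is `proj`. [cite: MochizukiAbsTopIII2015, Remark 3.5.1 p.78] -/
@[simp] theorem logPlusOverE_N_core :
    (L.logPlusOverE v).N ((logShapePlus (isArc := isArc) v).base ⟨.core, core_mem_two⟩) = L.proj := rfl

/-- The structure functor at `𝒳_⋎` is `proj`. [cite: MochizukiAbsTopIII2015, Remark 3.5.1 p.78] -/
@[simp] theorem logPlusOverE_N_row1 (n : ℤ) :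
    (L.logPlusOverE v).N ((logShapePlus (isArc := isArc) v).base ⟨.row1 n, row1_mem_two n⟩) = L.proj := rfl

/-- The over-isomorphism of `λ⊞_{v,ν}` is `lamOver v ν`. [cite: MochizukiAbsTopIII2015, Def 5.4 (iv) p. 127] -/
@[simp] theorem logPlusOverE_μ_lamEdge (ν : LogVertex (isArc v)) (hν : ν.isPostLog = false) :
    (L.logPlusOverE v).μ (lamEdge v ν hν) = L.lamOver v ν := rfl

/-- The over-isomorphism of `id_⋎` is the unitor. [cite: MochizukiAbsTopIII2015, Cor 5.5 p. 130] -/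
@[simp] theorem logPlusOverE_μ_toCoreEdge (n : ℤ) : (L.logPlusOverE v).μ (toCoreEdge v n) = L.proj.leftUnitor := rfl

/-- The over-isomorphism of `log` is `logOver`. [cite: MochizukiAbsTopIII2015, Def 5.4 (ii) p. 125] -/
@[simp] theorem logPlusOverE_μ_logEdge (n : ℤ) : (L.logPlusOverE v).μ (logEdge v n) = L.logOver := rfl

/-! ## The structure isomorphisms along the observable's generator paths, componentwise -/

/-- `F.map` respects heterogeneous equality of morphisms with equal endpoints. [folklore] -/
private theorem map_heq {C D : Type*} [Category C] [Category D] (F : C ⥤ D) {X Y X' Y' : C} {f : X ⟶ Y} {g : X' ⟶ Y'}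
    (hX : X = X') (hY : Y = Y') (h : HEq f g) : HEq (F.map f) (F.map g) := by
  subst hX hY
  cases h
  rfl

/-- Components of a natural transformation at equal objects are heterogeneously equal. [folklore] -/
private theorem app_heq {C D : Type*} [Category C] [Category D] {F G : C ⥤ D} (α : F ⟶ G) {y y' : C} (h : y = y') :
    HEq (α.app y) (α.app y') := by
  subst h
  rfl

/-- The path functor of the empty path on an object of `□` / `𝒳_⋎`. [cite: MochizukiAbsTopIII2015, Definition 3.5 (i) p.75] -/
private theorem pf_nil_obj (c : (logShapePlus (isArc := isArc) v).Vertex) (x : (L.logDiagramPlus v).obj c) :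
    ((L.logDiagramPlus v).pathFunctor (Quiver.Path.nil : Quiver.Path c c)).obj x = x :=
  (L.logDiagramPlus v).pathFunctor_nil_obj c x

/-- The empty path at `𝒳_{⋎+1}` (bookkeeping abbreviation). [cite: MochizukiAbsTopIII2015, Definition 3.5 (i) p.75] -/
private abbrev nilRow1 (n : ℤ) :
    Quiver.Path ((logShapePlus (isArc := isArc) v).base ⟨DVertex.row1 (n + 1), row1_mem_two (n + 1)⟩)
      ((logShapePlus (isArc := isArc) v).base ⟨DVertex.row1 (n + 1), row1_mem_two (n + 1)⟩) :=
  Quiver.Path.nil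

/-- Along `[λ⊞_{v,ν}]`: the structure isomorphism is `lamOver v ν` (componentwise, heterogeneously — the path functor of
`[λ⊞_ν]` is `𝟭 ⋙ λ⊞_ν`). [cite: MochizukiAbsTopIII2015, Def 5.4 (iv) p. 127] -/
theorem pathIso_lamPath_hom_app_heq (ν : LogVertex (isArc v)) (hν : ν.isPostLog = false) (x : L.X) :
    HEq (((L.logPlusOverE v).pathIso (lamPath v ν hν)).hom.app x) ((L.lamOver v ν).hom.app x) := by
  rw [show lamPath (isArc := isArc) v ν hν = Path.nil.cons (lamEdge v ν hν) from rfl,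
    DiagramOfCategories.OverData.pathIso_cons_app, DiagramOfCategories.OverData.pathIso_nil_app]
  refine (eqToHom_comp_heq _ _).trans ((comp_eqToHom_heq _ _).trans ?_)
  rw [logPlusOverE_μ_lamEdge]
  exact app_heq _ (L.pf_nil_obj v ((logShapePlus (isArc := isArc) v).base ⟨.core, core_mem_two⟩) x)

/-- Along `[λ⊞_{ν₂}] ∘ [id_{⋎+1}]`: the structure isomorphism is `lamOver v ν₂` (the unitor contributes an identity).
[cite: MochizukiAbsTopIII2015, Def 5.4 (iv) p. 127] -/
theorem pathIso_postLogCodPath_hom_app_heq (n : ℤ) (ν₂ : LogVertex (isArc v)) (h₂ : ν₂.isPostLog = false) (x : L.X) :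
    HEq (((L.logPlusOverE v).pathIso (postLogCodPath v n ν₂ h₂)).hom.app x) ((L.lamOver v ν₂).hom.app x) := by
  have hy₀ := L.pf_nil_obj v ((logShapePlus (isArc := isArc) v).base ⟨.row1 (n + 1), row1_mem_two (n + 1)⟩) x
  have hy₁ : ((L.logDiagramPlus v).pathFunctor (Path.nil.cons (toCoreEdge v (n + 1)))).obj x = x :=
    (Functor.congr_obj ((L.logDiagramPlus v).pathFunctor_cons Path.nil (toCoreEdge v (n + 1))) x).trans hy₀
  rw [show postLogCodPath (isArc := isArc) v n ν₂ h₂ = (Path.nil.cons (toCoreEdge v (n + 1))).cons (lamEdge v ν₂ h₂)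
      from rfl,
    DiagramOfCategories.OverData.pathIso_cons_app, DiagramOfCategories.OverData.pathIso_cons_app,
    DiagramOfCategories.OverData.pathIso_nil_app, logPlusOverE_μ_lamEdge, logPlusOverE_μ_toCoreEdge]
  refine (eqToHom_comp_heq _ _).trans ?_
  have e1 : HEq ((L.lamOver v ν₂).hom.app
      (((L.logDiagramPlus v).pathFunctor (Path.nil.cons (toCoreEdge v (n + 1)))).obj x)) ((L.lamOver v ν₂).hom.app x) :=
    app_heq _ hy₁
  have e2 : HEq (L.proj.leftUnitor.hom.app (((L.logDiagramPlus v).pathFunctor (nilRow1 (isArc := isArc) v n)).obj x))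
      (𝟙 (L.proj.obj x)) := by
    rw [hy₀]
    exact heq_of_eq (by simp)
  refine (heq_comp (by rw [hy₁]) (by rw [hy₁]; try rfl) rfl e1
    ((eqToHom_comp_heq _ _).trans ((comp_eqToHom_heq _ _).trans e2))).trans ?_
  exact heq_of_eq (Category.comp_id _)

/-- Along `[λ⊞_{space-link}] ∘ [id_⋎] ∘ [log]`: the structure isomorphism is `lamOver v space-link` at `log X` followed by
`logOver` at `X`. [cite: MochizukiAbsTopIII2015, Def 5.4 (ii) p. 125] -/
theorem pathIso_postLogDomPath_hom_app_heq (n : ℤ) (hsl : (LogVertex.spaceLink (isArc v)).isPostLog = false) (x : L.X) :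
    HEq (((L.logPlusOverE v).pathIso (postLogDomPath v n hsl)).hom.app x)
      ((L.lamOver v (LogVertex.spaceLink (isArc v))).hom.app (L.log.obj x) ≫ L.logOver.hom.app x) := by
  have hy₀ := L.pf_nil_obj v ((logShapePlus (isArc := isArc) v).base ⟨.row1 (n + 1), row1_mem_two (n + 1)⟩) x
  have hy₁ : ((L.logDiagramPlus v).pathFunctor (Path.nil.cons (logEdge v n))).obj x = L.log.obj x :=
    (Functor.congr_obj ((L.logDiagramPlus v).pathFunctor_cons Path.nil (logEdge v n)) x).trans (congrArg L.log.obj hy₀)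
  have hy₂ : ((L.logDiagramPlus v).pathFunctor ((Path.nil.cons (logEdge v n)).cons (toCoreEdge v n))).obj x =
      L.log.obj x :=
    (Functor.congr_obj ((L.logDiagramPlus v).pathFunctor_cons (Path.nil.cons (logEdge v n)) (toCoreEdge v n)) x).trans
      hy₁
  rw [show postLogDomPath (isArc := isArc) v n hsl =
      ((Path.nil.cons (logEdge v n)).cons (toCoreEdge v n)).cons (lamEdge v _ hsl) from rfl,
    DiagramOfCategories.OverData.pathIso_cons_app, DiagramOfCategories.OverData.pathIso_cons_app,
    DiagramOfCategories.OverData.pathIso_cons_app, DiagramOfCategories.OverData.pathIso_nil_app,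
    logPlusOverE_μ_lamEdge, logPlusOverE_μ_toCoreEdge, logPlusOverE_μ_logEdge]
  refine (eqToHom_comp_heq _ _).trans ?_
  have e1 : HEq ((L.lamOver v (LogVertex.spaceLink (isArc v))).hom.app
      (((L.logDiagramPlus v).pathFunctor ((Path.nil.cons (logEdge v n)).cons (toCoreEdge v n))).obj x))
      ((L.lamOver v (LogVertex.spaceLink (isArc v))).hom.app (L.log.obj x)) :=
    app_heq _ hy₂
  have e2 : HEq (L.proj.leftUnitor.hom.app (((L.logDiagramPlus v).pathFunctor (Path.nil.cons (logEdge v n))).obj x))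
      (𝟙 (L.proj.obj (L.log.obj x))) := by
    rw [hy₁]
    exact heq_of_eq (by simp)
  have e3 : HEq (L.logOver.hom.app (((L.logDiagramPlus v).pathFunctor (nilRow1 (isArc := isArc) v n)).obj x))
      (L.logOver.hom.app x) :=
    app_heq _ hy₀
  -- the tail `unitor ≫ logOver`, casts stripped
  have e23 : HEq (L.proj.leftUnitor.hom.app (((L.logDiagramPlus v).pathFunctor (Path.nil.cons (logEdge v n))).obj x) ≫
      (eqToHom (by rw [DiagramOfCategories.pathFunctor_cons]; try rfl) ≫
        L.logOver.hom.app (((L.logDiagramPlus v).pathFunctor (nilRow1 (isArc := isArc) v n)).obj x) ≫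
        eqToHom (by rw [DiagramOfCategories.pathFunctor_nil]; try rfl)))
      (𝟙 (L.proj.obj (L.log.obj x)) ≫ L.logOver.hom.app x) :=
    heq_comp (congrArg (fun y => L.proj.obj y) hy₁) (congrArg (fun y => L.proj.obj y) hy₁) rfl e2
      ((eqToHom_comp_heq _ _).trans ((comp_eqToHom_heq _ _).trans e3))
  refine (heq_comp (by rw [hy₂]) (by rw [hy₂]; try rfl) rfl e1 ((eqToHom_comp_heq _ _).trans e23)).trans ?_
  exact heq_of_eq (by simp)

/-! ## The generator homotopies of `S_log⊞_v` lie over `Th•[Z]` -/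

/-- **Both printed kinds of generator pairs of `S_log⊞_v` carry OVER-homotopies**, GIVEN abc-iut-L4-t3's add-ons `IotaOver`
(the `ι⊞_{v,ε}` lie over `Th•[Z]`) and `LamOverLink` (one over-structure at the identified space-link / post-log vertices):
for the pre-log pairs `([λ⊞_{ν₁}], [λ⊞_{ν₂}])` by `IotaOver.toE_map_iota_heq_of_preLog`, for the post-log pairs
`([λ⊞_{sl}]∘[id_⋎]∘[log], [λ⊞_{ν₂}]∘[id_{⋎+1}])` by `IotaOver.toE_map_iota_heq_spaceLink` — abc-iut-f-102's `hpre` / `hpost`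
computation against the observable's own over-datum `logPlusOverE v`. [cite: MochizukiAbsTopIII2015, Def 5.4 (vii) p. 128] -/
theorem isOver_logGenHom (hι : L.IotaOver) (hΛ : L.LamOverLink) :
    ∀ ⦃c b : (logShapePlus (isArc := isArc) v).Vertex⦄ ⦃g g' : Path c b⦄ (s : LogGen v g g'),
      (L.logPlusOverE v).IsOver g g' (L.logGenHom v s)
  | _, _, _, _, LogGen.pre ν₁ ν₂ ε h₁ h₂ => by
    refine (Iso.eq_comp_inv _).mpr ?_
    ext x
    rw [NatTrans.comp_app, Functor.whiskerRight_app]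
    apply eq_of_heq
    refine HEq.trans ?_ (L.pathIso_lamPath_hom_app_heq v ν₁ h₁ x).symm
    -- the homotopy, pushed down to `Th•[Z]`, is `A_{ν₁} ∘ A_{ν₂}⁻¹`
    have hθ : HEq (((L.logPlusOverE v).N (logShapePlus (isArc := isArc) v).obs).map
        ((L.logGenHom v (LogGen.pre ν₁ ν₂ ε h₁ h₂)).app x))
        ((L.lamOver v ν₁).hom.app x ≫ (L.lamOver v ν₂).inv.app x) := by
      have k : HEq ((L.logGenHom v (LogGen.pre ν₁ ν₂ ε h₁ h₂)).app x) ((L.iota v ε).app x) := by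
        simp only [logGenHom, NatTrans.comp_app, eqToHom_app]
        exact (eqToHom_comp_heq _ _).trans (comp_eqToHom_heq _ _)
      exact (map_heq (L.forget v ⋙ L.toE v) (Functor.congr_obj (L.pathFunctor_lamPath v ν₁ h₁) x)
        (Functor.congr_obj (L.pathFunctor_lamPath' v ν₂ h₂) x).symm k).trans (hι.toE_map_iota_heq_of_preLog v ε h₁ x)
    have hP := L.pathIso_lamPath_hom_app_heq v ν₂ h₂ x
    refine (heq_comp ?_ ?_ rfl hθ hP).trans (heq_of_eq (by simp))
    · exact (congrArg (fun F => (L.forget v ⋙ L.toE v).obj (F.obj x)) (L.pathFunctor_lamPath v ν₁ h₁)).trans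
        (by rw [h₁]; try rfl)
    · exact congrArg (fun F => (L.forget v ⋙ L.toE v).obj (F.obj x)) (L.pathFunctor_lamPath' v ν₂ h₂).symm
  | _, _, _, _, LogGen.post ν₁ ν₂ ε h₁ h₂ hsl n => by
    refine (Iso.eq_comp_inv _).mpr ?_
    ext x
    rw [NatTrans.comp_app, Functor.whiskerRight_app]
    apply eq_of_heq
    refine HEq.trans ?_ (L.pathIso_postLogDomPath_hom_app_heq v n hsl x).symm
    -- the homotopy, pushed down to `Th•[Z]`, is `A_{sl, log X} ∘ Ξ_X ∘ A_{ν₂,X}⁻¹` (uses `LamOverLink`)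
    have hθ : HEq (((L.logPlusOverE v).N (logShapePlus (isArc := isArc) v).obs).map
        ((L.logGenHom v (LogGen.post ν₁ ν₂ ε h₁ h₂ hsl n)).app x))
        (((L.lamOver v (LogVertex.spaceLink (isArc v))).hom.app (L.log.obj x) ≫ L.logOver.hom.app x) ≫
          (L.lamOver v ν₂).inv.app x) := by
      have k : HEq ((L.logGenHom v (LogGen.post ν₁ ν₂ ε h₁ h₂ hsl n)).app x) ((L.iota v ε).app x) := by
        simp only [logGenHom, NatTrans.comp_app, eqToHom_app]
        exact (eqToHom_comp_heq _ _).trans (comp_eqToHom_heq _ _)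
      refine (map_heq (L.forget v ⋙ L.toE v) (Functor.congr_obj (L.pathFunctor_postLogDomPath v ν₁ h₁ n hsl) x)
        (Functor.congr_obj (L.pathFunctor_postLogCodPath v n ν₂ h₂) x).symm k).trans ?_
      exact (hι.toE_map_iota_heq_spaceLink hΛ v ε h₁ x).trans (heq_of_eq (Category.assoc _ _ _).symm)
    have hP := L.pathIso_postLogCodPath_hom_app_heq v n ν₂ h₂ x
    refine (heq_comp ?_ ?_ rfl hθ hP).trans (heq_of_eq (by simp))
    · refine (congrArg (fun F => (L.forget v ⋙ L.toE v).obj (F.obj x)) (L.pathFunctor_postLogDomPath v ν₁ h₁ n hsl)).trans ?_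
      rw [h₁, LogVertex.eq_postLog_of_isPostLog _ h₁, ← L.lam_spaceLink_eq_postLog v]
      rfl
    · exact congrArg (fun F => (L.forget v ⋙ L.toE v).obj (F.obj x)) (L.pathFunctor_postLogCodPath v n ν₂ h₂).symm

/-- ★ **Every homotopy of the constructed observable `S_log⊞_v` lies over `Th•[Z]`** (GIVEN `IotaOver`, `LamOverLink`, and
the square hypothesis under which abc-iut-f-101's `logObsFamily` exists): the generators do (`isOver_logGenHom`), hence
every chain composite does (this seat's `isOver_chainFamily_η`).  The hypothesis «hover⊞» of the Cor 5.10 (iv)(b)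
compatibility closer in over-datum form. [cite: MochizukiAbsTopIII2015, Cor 5.5 (iii) p. 131] -/
theorem isOver_logObsFamily_η (hι : L.IotaOver) (hΛ : L.LamOverLink) (hsq : L.IotaSquaresCommute v)
    {a b : (logShapePlus (isArc := isArc) v).Vertex} {p q : Path a b} (h : (L.logObsFamily v hsq).E p q) :
    (L.logPlusOverE v).IsOver p q ((L.logObsFamily v hsq).η h) :=
  DiagramOfCategories.isOver_chainFamily_η (L.logPlusOverE v) (LogGen v) (L.logGenHom v)
    (L.isOver_logGenHom v hι hΛ) (logShapePlus v).obs (isEmpty_hom_logObs v)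
    (fun p q c c' => L.chain_hom_eq v hsq p q c c') h

/-- The same over any category UNDER `Th•[Z]` (post-composition of the structure functors with a functor
`F : Th•[Z] ⥤ 𝒞′`, e.g. the mono-analyticisation `Th•[Z] → Th⊢[Z] ⥲ An⊢[𝒩⊢⊞]` of Cor 5.10 (iv)): `IsOver.map`.
[cite: MochizukiAbsTopIII2015, Cor 5.10 (iv)(b) p. 147] -/
theorem isOver_logObsFamily_η_map (hι : L.IotaOver) (hΛ : L.LamOverLink) (hsq : L.IotaSquaresCommute v)
    {C' : Type (u + 1)} [Category.{u} C'] (F : L.E ⥤ C')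
    {a b : (logShapePlus (isArc := isArc) v).Vertex} {p q : Path a b} (h : (L.logObsFamily v hsq).E p q) :
    ((L.logPlusOverE v).map F).IsOver p q ((L.logObsFamily v hsq).η h) :=
  DiagramOfCategories.OverData.IsOver.map F (L.isOver_logObsFamily_η v hι hΛ hsq h)

end LogFrobeniusSetting

end Literature.AnabelianGeometry.AbsoluteAnabelian
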